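import Literature.RingTheory.CohomologyAnnihilator.SyzygyDescent
import Literature.RingTheory.CohomologyAnnihilator.SyzygyBasic
import HarnessLib

/-!
# Birational persistence of the cohomology annihilator from syzygy descent UP TO Ω-CLOSURE

Topic: `Literature/RingTheory/CohomologyAnnihilator`.

Folklore homological algebra continuing the sibling file `SyzygyDescent`: there, persistence of
`caᵗ⁺¹(B)` along a birational ring map `B → C` (`[Algebra B C]`, `C` torsion-free over `B`,
every `s : C` with `b · s = r · 1` for some `b ∈ B⁰`) is derived from the hypothesis that EVERY
high `C`-syzygy is ITSELF generated over `C` by an injective `B`-linear image of a high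
`B`-syzygy ("syzygy descent"). The class of `C`-modules `Y` with `c · Ext^{≥1}_C(Y, −) = 0` is,
however, closed under isomorphism, finite direct sums, direct summands (retracts) and — by
injective dimension shifting along `0 → ΩY → P → Y → 0` with `P` projective — under taking
syzygies [IyengarTakahashi2014, §2 (Remark 2.3) and the proof of Lemma 4.2]. So the descent
hypothesis may be weakened to: every high `C`-syzygy lies in the **Ω-closure** (`OmegaClosure`)
of the class of such "strict transforms" of high `B`-syzygies (`StrictTransformOfSyzygy`); the
resulting structural condition is `STD t e` and the persistence statement is
`algebraMap_mem_cohomologyAnnihilatorOfDegree_of_STD`. (Printed shadow: the weak MCM-extending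
property of a map of Gorenstein rings implies `f(ca R) ⊆ ca S` [Esentepe2018, Thm. 5.1].)

* `OmegaClosure G` — the smallest class of `C`-modules containing `G` and the finitely generated
  projectives, closed under isomorphism, binary products, retracts and first syzygies
  (`IsSyzygy 1`); `OmegaClosure.mono`, `OmegaClosure.of_isSyzygy` (closed under `IsSyzygy s`).
* `ext_smul_eq_zero_of_prod` — `a` kills `Extⁿ(Y₁ × Y₂, N)` if it kills `Extⁿ(Y₁, N)` and
  `Extⁿ(Y₂, N)` (`𝟙 = fst ≫ inl + snd ≫ inr`, `Ext` additive).
* `smul_ext_eq_zero_of_omegaClosure` — if `a · Ext^{≥1}(Y, −) = 0` for all `Y ∈ G`, then for all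
  `Y ∈ OmegaClosure G`.
* `mem_cohomologyAnnihilatorOfDegree_succ_of_omegaClosure` — if moreover every `e`-th syzygy of
  every finitely generated `C`-module lies in `OmegaClosure G`, then `a ∈ caᵉ⁺¹(C)` (surjective
  dimension shifting `mem_extAnnihilatorFrom_of_isSyzygy`). No second ring is involved.
* `StrictTransformOfSyzygy B t Y`, `STD B C t e` — the generating class "`Y` is generated over `C`
  by an injective `algebraMap`-semilinear image of a `(t+1)`-th syzygy of a finitely generated
  `B`-module" and the condition "every `e`-th `C`-syzygy of a finitely generated `C`-module lies
  in the Ω-closure of the strict transforms".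
* `algebraMap_mem_cohomologyAnnihilatorOfDegree_of_STD` — for `B → C` birational with `B`, `C`
  noetherian and `C` torsion-free over `B`: `STD t e` and `c ∈ caᵗ⁺¹(B)` imply
  `algebraMap B C c ∈ caᵉ⁺¹(C)` (base case: `smul_ext_eq_zero_of_isSyzygy_of_isBirational` of
  `SyzygyDescent`); `algebraMap_mem_cohomologyAnnihilator_of_STD` (the `ca` form) and
  `Subalgebra.algebraMap_mem_cohomologyAnnihilatorOfDegree_of_STD` (subalgebras `B`, `C` of a
  field with `C ⊆ Frac B`).

Conventions as in `SyzygyDescent`/`BirationalTransfer`: `B C : Type u`, modules in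
`ModuleCat.{u}`, `Ext = CategoryTheory.Abelian.Ext.{u}`.

## References

* S. B. Iyengar, R. Takahashi, *Annihilation of cohomology and strong generation of module
  categories*, IMRN 2016; arXiv:1404.1476 — §2 (Remark 2.3), Lemma 4.2. [`IyengarTakahashi2014`]
* Ö. Esentepe, *The cohomology annihilator of a curve singularity*, J. Algebra 2020;
  arXiv:1807.07918 — Thm. 5.1. [`Esentepe2018`]
-/

noncomputable section

open CategoryTheory CategoryTheory.Abelian

open scoped nonZeroDivisors

universe u

namespace Literature.RingTheory.CohomologyAnnihilator

/-! ## The Ω-closure of a class of modules -/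

section Closure

variable {C : Type u} [CommRing C]

/-- **The Ω-closure of a class `G` of `C`-modules**: the smallest class containing `G` and the
finitely generated projective modules which is closed under isomorphism, binary products,
retracts (direct summands) and first syzygies (`IsSyzygy 1 Y K`: `0 → K → P → Y → 0` exact with
`P` finitely generated projective). [cite: IyengarTakahashi2014, §2 (Syzygy modules), Def. 4.1] -/
inductive OmegaClosure (G : ModuleCat.{u} C → Prop) : ModuleCat.{u} C → Prop
  | base {Y : ModuleCat.{u} C} : G Y → OmegaClosure G Y
  | proj {P : ModuleCat.{u} C} : Module.Finite C P → Projective P → OmegaClosure G P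
  | iso {Y Y' : ModuleCat.{u} C} : OmegaClosure G Y → Nonempty (Y ≅ Y') → OmegaClosure G Y'
  | prod {Y₁ Y₂ : ModuleCat.{u} C} :
      OmegaClosure G Y₁ → OmegaClosure G Y₂ → OmegaClosure G (ModuleCat.of C (Y₁ × Y₂))
  | retract {Y Y' : ModuleCat.{u} C} (i : Y' ⟶ Y) (r : Y ⟶ Y') :
      i ≫ r = 𝟙 Y' → OmegaClosure G Y → OmegaClosure G Y'
  | syzygy {Y K : ModuleCat.{u} C} : OmegaClosure G Y → IsSyzygy 1 Y K → OmegaClosure G K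

/-- The Ω-closure is monotone in the generating class. [cite: IyengarTakahashi2014, Def. 4.1] -/
theorem OmegaClosure.mono {G G' : ModuleCat.{u} C → Prop} (hGG' : ∀ Y, G Y → G' Y)
    {Y : ModuleCat.{u} C} (hY : OmegaClosure G Y) : OmegaClosure G' Y := by
  induction hY with
  | base h => exact OmegaClosure.base (hGG' _ h)
  | proj hfin hproj => exact OmegaClosure.proj hfin hproj
  | iso _ hiso ih => exact OmegaClosure.iso ih hiso
  | prod _ _ ih₁ ih₂ => exact OmegaClosure.prod ih₁ ih₂
  | retract i r h _ ih => exact OmegaClosure.retract i r h ih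
  | syzygy _ hs ih => exact OmegaClosure.syzygy ih hs

/-- The Ω-closure is closed under higher syzygies: if `Y ∈ OmegaClosure G` and `K` is an `s`-th
syzygy of `Y`, then `K ∈ OmegaClosure G` (peel first syzygies, `isSyzygy_succ_iff_exists_first`).
[cite: IyengarTakahashi2014, §2 (Syzygy modules)] -/
theorem OmegaClosure.of_isSyzygy {G : ModuleCat.{u} C → Prop} :
    ∀ (s : ℕ) {Y K : ModuleCat.{u} C}, OmegaClosure G Y → IsSyzygy s Y K → OmegaClosure G K
  | 0, _, _, hY, ⟨i⟩ => OmegaClosure.iso hY ⟨i.symm⟩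
  | s + 1, _, _, hY, hK => by
    obtain ⟨Y', h1, hs⟩ := isSyzygy_succ_iff_exists_first.mp hK
    exact OmegaClosure.of_isSyzygy s (OmegaClosure.syzygy hY h1) hs

/-! ## Annihilation of `Ext` is inherited by the Ω-closure -/

/-- If `a` kills `Extⁿ(Y₁, N)` and `Extⁿ(Y₂, N)` then `a` kills `Extⁿ(Y₁ × Y₂, N)`
(`𝟙 = fst ≫ inl + snd ≫ inr` on `Y₁ × Y₂`, and `Ext` is additive in the first variable).
[cite: IyengarTakahashi2014, Lemma 4.2 (proof)] -/
theorem ext_smul_eq_zero_of_prod {Y₁ Y₂ N : ModuleCat.{u} C} {n : ℕ} (a : C)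
    (h₁ : ∀ e : Ext.{u} Y₁ N n, a • e = 0) (h₂ : ∀ e : Ext.{u} Y₂ N n, a • e = 0)
    (e : Ext.{u} (ModuleCat.of C (Y₁ × Y₂)) N n) : a • e = 0 := by
  let fst : ModuleCat.of C (Y₁ × Y₂) ⟶ Y₁ := ModuleCat.ofHom (LinearMap.fst C Y₁ Y₂)
  let snd : ModuleCat.of C (Y₁ × Y₂) ⟶ Y₂ := ModuleCat.ofHom (LinearMap.snd C Y₁ Y₂)
  let inl : Y₁ ⟶ ModuleCat.of C (Y₁ × Y₂) := ModuleCat.ofHom (LinearMap.inl C Y₁ Y₂)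
  let inr : Y₂ ⟶ ModuleCat.of C (Y₁ × Y₂) := ModuleCat.ofHom (LinearMap.inr C Y₁ Y₂)
  have hid : fst ≫ inl + snd ≫ inr = 𝟙 (ModuleCat.of C (Y₁ × Y₂)) := by
    apply ModuleCat.hom_ext
    refine LinearMap.ext fun v => ?_
    simp only [ModuleCat.hom_add, ModuleCat.hom_comp, LinearMap.add_apply, LinearMap.coe_comp,
      Function.comp_apply, ModuleCat.hom_id, LinearMap.id_coe, id_eq]
    simp [fst, snd, inl, inr]
  have he : e = (Ext.mk₀ fst).comp ((Ext.mk₀ inl).comp e (zero_add n)) (zero_add n) +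
      (Ext.mk₀ snd).comp ((Ext.mk₀ inr).comp e (zero_add n)) (zero_add n) := by
    rw [Ext.mk₀_comp_mk₀_assoc, Ext.mk₀_comp_mk₀_assoc, ← Ext.add_comp, ← Ext.mk₀_add, hid,
      Ext.mk₀_id_comp]
  rw [he, smul_add, ← Ext.comp_smul, h₁, Ext.comp_zero, zero_add, ← Ext.comp_smul, h₂,
    Ext.comp_zero]

/-- **Annihilation of positive `Ext` is inherited by the Ω-closure.** If `a · Extⁱ(Y, N) = 0` for
every `Y ∈ G`, every `C`-module `N` and every `i ≥ 1`, then the same holds for every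
`Y ∈ OmegaClosure G`: projectives have vanishing positive `Ext` (stable annihilation with
`ι = a • 𝟙`), isomorphisms and retracts by functoriality (`ext_smul_eq_zero_of_retract`),
products by additivity (`ext_smul_eq_zero_of_prod`), first syzygies by injective dimension
shifting (`smul_ext_eq_zero_of_shortExact_of_projective`).
[cite: IyengarTakahashi2014, Remark 2.3, Lemma 4.2 (proof)] -/
theorem smul_ext_eq_zero_of_omegaClosure {G : ModuleCat.{u} C → Prop} {a : C}
    (hG : ∀ Y : ModuleCat.{u} C, G Y → ∀ (N : ModuleCat.{u} C) (i : ℕ), 1 ≤ i →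
      ∀ e : Ext.{u} Y N i, a • e = 0)
    {Y : ModuleCat.{u} C} (hY : OmegaClosure G Y) :
    ∀ (N : ModuleCat.{u} C) (i : ℕ), 1 ≤ i → ∀ e : Ext.{u} Y N i, a • e = 0 := by
  induction hY with
  | base h => exact hG _ h
  | @proj P _ hproj =>
    intro N i hi e
    haveI := hproj
    exact smul_ext_eq_zero_of_comp_eq_smul_id (a • 𝟙 P) (𝟙 P) (by rw [Category.comp_id]) hi e
  | iso _ hiso ih =>
    obtain ⟨f⟩ := hiso
    intro N i hi e
    exact ext_smul_eq_zero_of_retract f.inv f.hom f.inv_hom_id a (fun e' => ih N i hi e') e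
  | prod _ _ ih₁ ih₂ =>
    intro N i hi e
    exact ext_smul_eq_zero_of_prod a (fun e' => ih₁ N i hi e') (fun e' => ih₂ N i hi e') e
  | retract ι r h _ ih =>
    intro N i hi e
    exact ext_smul_eq_zero_of_retract ι r h a (fun e' => ih N i hi e') e
  | syzygy _ hs ih =>
    obtain ⟨P, _, hPproj, f, g, w, hS⟩ := isSyzygy_one_iff.mp hs
    intro N i hi e
    haveI : Projective (ShortComplex.mk f g w).X₂ := hPproj
    exact smul_ext_eq_zero_of_shortExact_of_projective hS hi (fun e' => ih N (i + 1) (by omega) e') e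

/-- **Ω-closure criterion for `caᵉ⁺¹`.** Let `C` be noetherian, `a : C`, `e : ℕ` and `G` a class
of `C`-modules with `a · Ext^{≥1}(Y, −) = 0` for all `Y ∈ G`. If every (finitely generated)
`e`-th syzygy of every finitely generated `C`-module lies in `OmegaClosure G`, then
`a ∈ caᵉ⁺¹(C)`: `a` kills `Ext^{≥1}(K, −)` for such a syzygy `K` (`smul_ext_eq_zero_of_omegaClosure`)
and hence `Ext^{≥ e+1}(M, −)` (surjective dimension shifting `mem_extAnnihilatorFrom_of_isSyzygy`).
[cite: IyengarTakahashi2014, Lemma 2.14, Lemma 4.2] -/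
theorem mem_cohomologyAnnihilatorOfDegree_succ_of_omegaClosure [IsNoetherianRing C]
    {G : ModuleCat.{u} C → Prop} {a : C} {e : ℕ}
    (hG : ∀ Y : ModuleCat.{u} C, G Y → ∀ (N : ModuleCat.{u} C) (i : ℕ), 1 ≤ i →
      ∀ x : Ext.{u} Y N i, a • x = 0)
    (hcl : ∀ (M K : ModuleCat.{u} C), Module.Finite C M → Module.Finite C K → IsSyzygy e M K →
      OmegaClosure G K) :
    a ∈ cohomologyAnnihilatorOfDegree C (e + 1) := by
  rw [mem_cohomologyAnnihilatorOfDegree_iff_forall_mem_extAnnihilatorFrom]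
  intro M hM
  haveI := hM
  obtain ⟨K, hKfin, hK⟩ := exists_isSyzygy M e
  have h1 : a ∈ extAnnihilatorFrom K 1 := by
    rw [mem_extAnnihilatorFrom_iff]
    intro i hi N _ x
    exact smul_ext_eq_zero_of_omegaClosure hG (hcl M K hM hKfin hK) N i hi x
  have h2 := mem_extAnnihilatorFrom_of_isSyzygy e hK h1
  rwa [Nat.add_comm] at h2

end Closure

/-! ## Strict transforms of high syzygies and the condition STD -/

section StrictTransform

variable {B C : Type u} [CommRing B] [CommRing C] [Algebra B C]

variable (B) in
/-- **`Y` is a strict transform of a high `B`-syzygy**: the `C`-module `Y` is generated over `C` by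
the image of an injective additive map `φ : Y₀ → Y`, semilinear over `algebraMap B C`, where `Y₀`
is a `(t+1)`-th syzygy module of a finitely generated `B`-module `X`. (For `B ⊆ C ⊆ Frac B` and
`Y₀` torsion-free this is `Y ≅ C · Y₀ ≅ (Y₀ ⊗_B C)/torsion`.)
[cite: IyengarTakahashi2014, §2 (Syzygy modules); Esentepe2018, Thm. 5.1] -/
def StrictTransformOfSyzygy (t : ℕ) (Y : ModuleCat.{u} C) : Prop :=
  ∃ (X Y₀ : ModuleCat.{u} B) (φ : Y₀ →+ Y), Module.Finite B X ∧ IsSyzygy (t + 1) X Y₀ ∧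
    (∀ (b : B) (y : Y₀), φ (b • y) = algebraMap B C b • φ y) ∧ Function.Injective φ ∧
    Submodule.span C (Set.range φ) = ⊤

variable (B C) in
/-- **STD_{t,e}(B → C)** ("strict transforms Ω-generate the high syzygies upstairs"): every `e`-th
syzygy module of every finitely generated `C`-module lies in the Ω-closure of the strict
transforms of `(t+1)`-th `B`-syzygies. [cite: Esentepe2018, Thm. 5.1] -/
def STD (t e : ℕ) : Prop :=
  ∀ (M K : ModuleCat.{u} C), Module.Finite C M → IsSyzygy e M K →
    OmegaClosure (StrictTransformOfSyzygy (C := C) B t) K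

/-- **Strict transforms of `(t+1)`-th `B`-syzygies are stably annihilated by `caᵗ⁺¹(B)`.** For
`B → C` birational with `B` noetherian and `C` torsion-free over `B`, `c ∈ caᵗ⁺¹(B)` and `Y` a
strict transform of a `(t+1)`-th `B`-syzygy: `algebraMap B C c` kills `Extⁱ_C(Y, N)` for every
`C`-module `N` and `i ≥ 1` (`smul_ext_eq_zero_of_isSyzygy_of_isBirational`, with the `B`-module
structure on `Y` restricted along `algebraMap B C`). [cite: IyengarTakahashi2014, Remark 2.3] -/
theorem smul_ext_eq_zero_of_strictTransformOfSyzygy [IsNoetherianRing B] [Module.IsTorsionFree B C]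
    {t : ℕ} {c : B} (hc : c ∈ cohomologyAnnihilatorOfDegree B (t + 1))
    (hbir : ∀ s : C, ∃ b : B, b ∈ B⁰ ∧ ∃ r : B, algebraMap B C b * s = algebraMap B C r)
    {Y : ModuleCat.{u} C} (hY : StrictTransformOfSyzygy B t Y) (N : ModuleCat.{u} C) {i : ℕ}
    (hi : 1 ≤ i) (e : Ext.{u} Y N i) : algebraMap B C c • e = 0 := by
  obtain ⟨X, Y₀, φ, hX, hY₀, hsemi, hinj, hspan⟩ := hY
  haveI := hX
  letI : Module B Y := Module.compHom Y (algebraMap B C)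
  haveI : IsScalarTower B C Y := IsScalarTower.of_algebraMap_smul fun _ _ => rfl
  let φ' : Y₀ →ₗ[B] Y :=
    { toFun := φ
      map_add' := φ.map_add
      map_smul' := fun b y => hsemi b y }
  exact smul_ext_eq_zero_of_isSyzygy_of_isBirational hc hY₀ hbir φ' hinj hspan N hi e

/-- **STD ⇒ birational persistence of `caᵗ⁺¹`** (the Ω-closed form of syzygy descent). Let
`B → C` be birational (every `s : C` has `b · s = r · 1` with `b ∈ B⁰`, `r : B`) with `B`, `C`
noetherian and `C` torsion-free over `B`. If `STD B C t e` holds — every `e`-th syzygy of a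
finitely generated `C`-module lies in the Ω-closure of the strict transforms of `(t+1)`-th
`B`-syzygies — then `c ∈ caᵗ⁺¹(B)` implies `algebraMap B C c ∈ caᵉ⁺¹(C)`
(`smul_ext_eq_zero_of_strictTransformOfSyzygy` on the generators, inherited by the Ω-closure,
`mem_cohomologyAnnihilatorOfDegree_succ_of_omegaClosure`).
[cite: IyengarTakahashi2014, Lemma 4.2; Esentepe2018, Thm. 5.1] -/
theorem algebraMap_mem_cohomologyAnnihilatorOfDegree_of_STD [IsNoetherianRing B]
    [IsNoetherianRing C] [Module.IsTorsionFree B C] {t e : ℕ} (hSTD : STD B C t e)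
    (hbir : ∀ s : C, ∃ b : B, b ∈ B⁰ ∧ ∃ r : B, algebraMap B C b * s = algebraMap B C r)
    {c : B} (hc : c ∈ cohomologyAnnihilatorOfDegree B (t + 1)) :
    algebraMap B C c ∈ cohomologyAnnihilatorOfDegree C (e + 1) :=
  mem_cohomologyAnnihilatorOfDegree_succ_of_omegaClosure
    (fun _ hY N _ hi x => smul_ext_eq_zero_of_strictTransformOfSyzygy hc hbir hY N hi x)
    (fun M K hM _ hK => hSTD M K hM hK)

/-- **STD in some degrees ⇒ birational persistence of `ca`.** Under the same birationality
hypotheses, if `c ∈ ca(B)` and for every `t` with `c ∈ caᵗ⁺¹(B)` some `STD B C t e` holds, then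
`algebraMap B C c ∈ ca(C)`. [cite: IyengarTakahashi2014, Def. 2.1; Esentepe2018, Thm. 5.1] -/
theorem algebraMap_mem_cohomologyAnnihilator_of_STD [IsNoetherianRing B] [IsNoetherianRing C]
    [Module.IsTorsionFree B C] {c : B} (hc : c ∈ cohomologyAnnihilator B)
    (hSTD : ∀ t : ℕ, c ∈ cohomologyAnnihilatorOfDegree B (t + 1) → ∃ e : ℕ, STD B C t e)
    (hbir : ∀ s : C, ∃ b : B, b ∈ B⁰ ∧ ∃ r : B, algebraMap B C b * s = algebraMap B C r) :
    algebraMap B C c ∈ cohomologyAnnihilator C := by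
  obtain ⟨n, hn⟩ := mem_cohomologyAnnihilator_iff.mp hc
  have hn' : c ∈ cohomologyAnnihilatorOfDegree B (n + 1) :=
    cohomologyAnnihilatorOfDegree_mono (Nat.le_succ n) hn
  obtain ⟨e, he⟩ := hSTD n hn'
  exact cohomologyAnnihilatorOfDegree_le (e + 1)
    (algebraMap_mem_cohomologyAnnihilatorOfDegree_of_STD he hbir hn')

end StrictTransform

/-! ### Subalgebras `B`, `C` of a field with `C ⊆ Frac B` -/

section Subalgebra

open Literature.RingTheory.Localization

variable {k : Type u} {K : Type u} [CommRing k] [Field K] [Algebra k K] {B C : Subalgebra k K}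

/-- **STD ⇒ persistence, for subalgebras of a field.** Let `B`, `C` be subalgebras of a field `K`
with an algebra structure `↥B → ↥C` compatible with the inclusions into `K`, both noetherian,
with `C ⊆ Frac B` inside `K` (`∀ s ∈ C, ∃ b ∈ B, b ≠ 0 ∧ b * s ∈ B`). If `STD ↥B ↥C t e` holds and
`c ∈ caᵗ⁺¹(B)` then `algebraMap B C c ∈ caᵉ⁺¹(C)` (`↥C` is torsion-free over `↥B` by
`Subalgebra.isTorsionFree_of_isScalarTower`, birational by
`Subalgebra.exists_mem_nonZeroDivisors_mul_eq`). [cite: Esentepe2018, Thm. 5.1] -/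
theorem Subalgebra.algebraMap_mem_cohomologyAnnihilatorOfDegree_of_STD
    [Algebra B C] [IsScalarTower B C K] [IsNoetherianRing B] [IsNoetherianRing C]
    (hfrac : ∀ s ∈ C, ∃ b ∈ B, b ≠ 0 ∧ b * s ∈ B) {c : B} {t e : ℕ}
    (hSTD : STD ↥B ↥C t e) (hc : c ∈ cohomologyAnnihilatorOfDegree B (t + 1)) :
    algebraMap B C c ∈ cohomologyAnnihilatorOfDegree C (e + 1) :=
  haveI : Module.IsTorsionFree B C := Subalgebra.isTorsionFree_of_isScalarTower
  CohomologyAnnihilator.algebraMap_mem_cohomologyAnnihilatorOfDegree_of_STD hSTD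
    (Subalgebra.exists_mem_nonZeroDivisors_mul_eq hfrac) hc

end Subalgebra

end Literature.RingTheory.CohomologyAnnihilator

end
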